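import Literature.NumberTheory.Automorphic.HermitianLatticesAdaptedPlane
import HarnessLib

/-!
# Pairs of self-dual lattices in an alternating space over a discretely valued field: primitive vectors, the adapted
# hyperbolic plane, and splitting it off (the step of the symplectic elementary-divisor theorem)

Topic `NumberTheory/QuadraticForms`; namespace `Literature.NumberTheory.QuadraticForms.SymplecticLatticePair` (lane
`lit-hodgefound`, Track 2 foundations; seat `lit-hodgefound-p11`, generation 34, row g34-#4).  One plumbing `def` with body
(`projAlt`, the projection onto the orthogonal of a hyperbolic plane of an ALTERNATING form) and theorems; no named fact, no
instance, no notation.  This is the alternating companion of the tree's hermitian files `Automorphic/HermitianLatticesLocal`,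
`Automorphic/HermitianLatticesAdaptedPlane` (cell hodgecm-mathlib; O'Meara §82F, Jacobowitz §§4–5), whose VOCABULARY it reuses
verbatim: a bilinear form `B : BilinForm K V` is a `RingHom.id`-sesquilinear form, so `IsUnimodularLattice B W L`
(finitely generated `𝒪`-submodule spanning the `K`-subspace `W`, `B(L, L) ⊆ 𝒪`, and dual-closed in `W`),
`IsHyperbolicPair B x y`, `orth B x y`, `orthInt B x y` and the uniformiser lemmas `exists_primitive_of_not_le'` etc. apply as
they stand.  What changes for alternating `B` (`B x x = 0`, `B y x = -B x y`): isotropy is automatic — no Hensel, no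
condition on `2`, no involution — and the projection onto `⟨x, y⟩^⊥` is `z ↦ z + (B y z) x - (B x z) y`.

## The print

The lattice proof of the CARTAN DECOMPOSITION `Sp_{2n}(K) = Sp_{2n}(𝒪) · T⁺ · Sp_{2n}(𝒪)` / of the SYMPLECTIC ELEMENTARY
DIVISOR THEOREM («given two self-dual lattices `L`, `M` there is a symplectic basis `x_i, y_i` of `L` with
`M = ⊕ 𝔭^{-aᵢ} xᵢ ⊕ 𝔭^{aᵢ} yᵢ`») runs: take `m ∈ M` of maximal level `a` relative to `L`, so that `x = ϖ^a m ∈ L` is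
primitive; a partner `y ∈ L` with `B x y = 1` exists by self-duality; then `ϖ^a y ∈ M` by self-duality of `M`, `x, y` is a
hyperbolic pair (alternating!), and both lattices split off their hyperbolic planes `𝒪x ⊕ 𝒪y`, `𝒪ϖ^{-a}x ⊕ 𝒪ϖ^{a}y` with the
SAME orthogonal complement; induct.  [Shimura1963AnalyticFamilies] G. Shimura, *On analytic families of polarized abelian
varieties and automorphic functions*, Ann. of Math. 78 (1963), §1 Prop. 1.6–1.7 (elementary divisors of lattices relative to an
alternating form); [AndrianovZhuravlev1995] A. N. Andrianov, V. G. Zhuravlev, *Modular Forms and Hecke Operators*, AMS (1995),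
Ch. 3 Lemma 3.3.6 («symplectic divisors»: `Γ g Γ ∋ diag(d₁, …, d_n; e₁, …, e_n)`, `dᵢ eᵢ = μ(g)`); the hermitian model of
exactly this argument is [Jacobowitz1962] §§4–5 and the tree's `HermitianLatticesAdaptedPlane`; [Kottwitz1992] §7 Lemma 7.4,
Case C, is where the symplectic Cartan decomposition is consumed («the double cosets of `K` in `G(ℚ_p)` are in one-to-one
correspondence with the orbits of `Ω_{ℚ_p}` on `X_*(S)`»).

## What is formalised (`K` a field with `Valued K ℤᵐ⁰`, `ϖ` a uniformiser `v ϖ = exp (-1)`, `B : BilinForm K V` alternating)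

* §1 `v_apply_comm_of_isAlt`, `pair_neg_of_isAlt` (`B y x = -1`), `exists_apply_eq_one_of_not_mem_of_isAlt` —
  a primitive vector of a unimodular lattice has a partner `B x y = 1` (82:17-type).
* §2 **primitive vectors exist**: `exists_pow_inv_smul_notMem` — a finitely generated `𝒪`-module contains no `K`-line
  (`ϖ^{-k} x ∉ L` for some `k`, by bounding the valuations of a linear functional on the generators), hence
  `exists_primitive_multiple` — every `x ≠ 0` of `L` has a primitive multiple `ϖ^{-k} x ∈ L`.
* §3 **the adapted hyperbolic pair, alternating case**: `exists_adapted_hyperbolicPair_of_isAlt` — for unimodular `L`, `M` in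
  `W ≠ ⊥` there are `a : ℕ` and a hyperbolic pair `x, y ∈ L` with `ϖ^{-a} x ∈ M`, `ϖ^{a} y ∈ M` (`a ≥ 1` iff `M ⊄ L`; for
  `M = L` any primitive vector with a partner).
* §4 **splitting**: `projAlt`, `projAlt_mem_orth`, `eq_add_projAlt`, `finrank_inf_orth_lt_of_isAlt`,
  **`IsUnimodularLattice.restrict_of_isAlt`** — a hyperbolic pair inside a unimodular lattice `N ⊆ W` splits it:
  `N ∩ ⟨x, y⟩^⊥` is unimodular in `W ∩ ⟨x, y⟩^⊥` and `N = (𝒪x + 𝒪y) ⊔ (N ∩ ⟨x, y⟩^⊥)`.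

The induction assembling adapted symplectic bases (the elementary-divisor theorem itself and the Cartan decomposition of
`Sp_{2n}`) is the sequel `SymplecticLatticePairAdaptedBasis`.

## References
* [Shimura1963AnalyticFamilies] G. Shimura, Ann. of Math. 78 (1963) 149–192, §1.
* [AndrianovZhuravlev1995] A. N. Andrianov, V. G. Zhuravlev, *Modular Forms and Hecke Operators*, Transl. Math. Monogr. 145
  (1995), Ch. 3 §3, Lemma 3.3.6.
* [Jacobowitz1962] R. Jacobowitz, *Hermitian forms over local fields*, Amer. J. Math. 84 (1962), §§4–5.
* [Omeara1963] O. T. O'Meara, *Introduction to Quadratic Forms* (1963), §81D (levels), §82F (unimodular lattices, 82:15, 82:17).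
* [Kottwitz1992] R. E. Kottwitz, J. AMS 5 (1992), §7 Lemma 7.4 (Case C).
-/

noncomputable section

open scoped Valued WithZero
open LinearMap (BilinForm)

namespace Literature.NumberTheory.QuadraticForms.SymplecticLatticePair

open Literature.NumberTheory.Automorphic.HermitianLattice

variable {K : Type*} [Field K] {V : Type*} [AddCommGroup V] [Module K V] {B : BilinForm K V}

/-! ## §1 Alternating forms: hyperbolic pairs and partners of primitive vectors -/

/-- In a hyperbolic pair of an alternating form, `B y x = -1`. [cite: Omeara1963, §42D] -/
theorem pair_neg_of_isAlt (hBa : B.IsAlt) {x y : V} (h : IsHyperbolicPair B x y) : B y x = -1 := by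
  rw [← hBa.neg_eq, h.pair]

/-- For an alternating form, `B y x ≠ 0` in a hyperbolic pair. [cite: Omeara1963, §42D] -/
theorem apply_ne_zero_of_isAlt (hBa : B.IsAlt) {x y : V} (h : IsHyperbolicPair B x y) : B y x ≠ 0 := by
  rw [pair_neg_of_isAlt hBa h]; exact neg_ne_zero.2 one_ne_zero

/-- A hyperbolic pair for an alternating form, from `B x y = 1` alone. [cite: Omeara1963, §42D] -/
theorem isHyperbolicPair_of_isAlt (hBa : B.IsAlt) {x y : V} (h : B x y = 1) : IsHyperbolicPair B x y :=
  ⟨hBa.self_eq_zero x, hBa.self_eq_zero y, h⟩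

variable [Valued K ℤᵐ⁰] {ϖ : K}

/-- For an alternating form, `v (B y x) = v (B x y)`. [cite: Omeara1963, §42D] -/
theorem v_apply_comm_of_isAlt (hBa : B.IsAlt) (x y : V) : Valued.v (B y x) = Valued.v (B x y) := by
  rw [← hBa.neg_eq, Valuation.map_neg]

/-- **Primitive vectors have partners (alternating form).**  If `x ∈ L` is primitive (`ϖ⁻¹ x ∉ L`) in the unimodular
lattice `L ⊆ W`, there is `y ∈ L` with `B x y = 1` — otherwise `B(x, L) ⊆ ϖ𝒪` and `ϖ⁻¹ x ∈ L^# ∩ W = L`.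
[cite: Omeara1963, §82F (82:17)] -/
theorem exists_apply_eq_one_of_not_mem_of_isAlt {W : Submodule K V} {L : Submodule 𝒪[K] V}
    (hϖ : Valued.v ϖ = WithZero.exp (-1 : ℤ)) (hBa : B.IsAlt) (hL : IsUnimodularLattice B W L) {x : V} (hx : x ∈ L)
    (hprim : ϖ⁻¹ • x ∉ L) : ∃ y ∈ L, B x y = 1 := by
  by_contra H
  push Not at H
  have hlt : ∀ y ∈ L, Valued.v (B x y) < 1 := by
    intro y hy
    rcases (hL.integral x hx y hy).lt_or_eq with h | h
    · exact h
    · exfalso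
      have hne : B x y ≠ 0 := fun h0 => by rw [h0, map_zero] at h; exact zero_ne_one h
      refine H ((B x y)⁻¹ • y) (smul_mem_of_v_le L (by rw [map_inv₀, h, inv_one]) hy) ?_
      rw [LinearMap.BilinForm.smul_right, inv_mul_cancel₀ hne]
  refine hprim (hL.dual _ (W.smul_mem _ (hL.le_span hx)) fun y hy => ?_)
  rw [LinearMap.BilinForm.smul_right, map_mul, map_inv₀, hϖ, v_apply_comm_of_isAlt hBa x y]
  have h1 : Valued.v (B x y) ≤ WithZero.exp (-1 : ℤ) := (v_lt_one_iff _).1 (hlt y hy)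
  calc (WithZero.exp (-1 : ℤ))⁻¹ * Valued.v (B x y)
      ≤ (WithZero.exp (-1 : ℤ))⁻¹ * WithZero.exp (-1 : ℤ) := mul_le_mul' le_rfl h1
    _ = 1 := inv_mul_cancel₀ WithZero.coe_ne_zero

/-! ## §2 Primitive vectors exist: a finitely generated `𝒪`-module contains no `K`-line -/

omit [Valued K ℤᵐ⁰] in
/-- Values of a linear functional on a finitely generated `𝒪`-module have bounded valuation (ultrametric inequality on an
`𝒪`-combination of the generators). [cite: Omeara1963, §81D] -/
private theorem exists_forall_v_le_of_fg [Valued K ℤᵐ⁰] {L : Submodule 𝒪[K] V} (hfg : L.FG) (f : V →ₗ[K] K) :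
    ∃ C : ℤᵐ⁰, ∀ z ∈ L, Valued.v (f z) ≤ C := by
  classical
  obtain ⟨S, hS⟩ := hfg
  refine ⟨S.sup fun s => Valued.v (f s), fun z hz => ?_⟩
  rw [← hS] at hz
  induction hz using Submodule.span_induction with
  | mem s hs => exact Finset.le_sup (f := fun s => Valued.v (f s)) hs
  | zero => rw [map_zero, map_zero]; exact zero_le
  | add u w _ _ hu hw =>
    rw [map_add]
    exact (Valuation.map_add _ _ _).trans (max_le hu hw)
  | smul a u _ hu =>
    rw [LinearMap.map_smul_of_tower, Submonoid.smul_def, smul_eq_mul, map_mul]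
    calc Valued.v (a : K) * Valued.v (f u) ≤ 1 * Valued.v (f u) := mul_le_mul' a.2 le_rfl
      _ ≤ S.sup fun s => Valued.v (f s) := by rw [one_mul]; exact hu

/-- **A finitely generated `𝒪`-submodule contains no `K`-line**: for `x ≠ 0` some `ϖ^{-k} x` lies outside `L` (a linear
functional `f` with `f x ≠ 0` has bounded valuation on `L`, while `v (f (ϖ^{-k} x)) = exp(k) · v (f x)` is unbounded).
[cite: Omeara1963, §81D] -/
theorem exists_pow_inv_smul_notMem {L : Submodule 𝒪[K] V} (hϖ : Valued.v ϖ = WithZero.exp (-1 : ℤ)) (hfg : L.FG)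
    {x : V} (hx : x ≠ 0) : ∃ k : ℕ, (ϖ ^ k)⁻¹ • x ∉ L := by
  obtain ⟨f, hf⟩ := Module.Projective.exists_dual_ne_zero K hx
  obtain ⟨C, hC⟩ := exists_forall_v_le_of_fg hfg f
  have hfx : Valued.v (f x) ≠ 0 := (Valuation.ne_zero_iff _).2 hf
  -- choose `k` with `exp k * v (f x) > C`
  obtain ⟨n, hn⟩ : ∃ n : ℤ, Valued.v (f x) = WithZero.exp n := ⟨_, (WithZero.exp_log hfx).symm⟩
  by_cases hC0 : C = 0
  · refine ⟨0, fun hmem => ?_⟩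
    have h := hC _ hmem
    rw [pow_zero, inv_one, one_smul, hC0] at h
    exact hfx (le_antisymm h zero_le)
  obtain ⟨c, hc⟩ : ∃ c : ℤ, C = WithZero.exp c := ⟨_, (WithZero.exp_log hC0).symm⟩
  refine ⟨(c - n + 1).toNat, fun hmem => ?_⟩
  have h := hC _ hmem
  rw [LinearMap.map_smul, smul_eq_mul, map_mul, map_inv₀, map_pow, hϖ, ← WithZero.exp_nsmul, ← WithZero.exp_neg, hn,
    ← WithZero.exp_add, hc, WithZero.exp_le_exp] at h
  simp only [nsmul_eq_mul, mul_neg, mul_one, neg_neg] at h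
  omega

/-- **Every non-zero vector of a finitely generated `𝒪`-module has a PRIMITIVE multiple** `x' = ϖ^{-k} x ∈ L`
(`ϖ⁻¹ x' ∉ L`): take `k` largest with `ϖ^{-k} x ∈ L`. [cite: Omeara1963, §81D] -/
theorem exists_primitive_multiple {L : Submodule 𝒪[K] V} (hϖ : Valued.v ϖ = WithZero.exp (-1 : ℤ)) (hfg : L.FG)
    {x : V} (hxL : x ∈ L) (hx : x ≠ 0) :
    ∃ k : ℕ, (ϖ ^ k)⁻¹ • x ∈ L ∧ ϖ⁻¹ • ((ϖ ^ k)⁻¹ • x) ∉ L := by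
  classical
  have hex := exists_pow_inv_smul_notMem hϖ hfg hx
  have hspec : (ϖ ^ Nat.find hex)⁻¹ • x ∉ L := Nat.find_spec hex
  have h0 : Nat.find hex ≠ 0 := by
    intro h0
    rw [h0, pow_zero, inv_one, one_smul] at hspec
    exact hspec hxL
  obtain ⟨k, hk⟩ : ∃ k, Nat.find hex = k + 1 := ⟨Nat.find hex - 1, by omega⟩
  have hkmem : (ϖ ^ k)⁻¹ • x ∈ L := by
    have := Nat.find_min hex (show k < Nat.find hex by omega)
    push Not at this
    exact this
  refine ⟨k, hkmem, ?_⟩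
  rw [hk] at hspec
  rwa [smul_smul, ← mul_inv, ← pow_succ']

/-! ## §3 The adapted hyperbolic pair of two self-dual lattices, alternating case -/

/-- **A hyperbolic pair inside a non-zero unimodular lattice** (alternating form): a primitive vector and a partner.
[cite: Omeara1963, §82F (82:17)] -/
theorem exists_hyperbolicPair_of_isAlt {W : Submodule K V} {L : Submodule 𝒪[K] V}
    (hϖ : Valued.v ϖ = WithZero.exp (-1 : ℤ)) (hBa : B.IsAlt) (hL : IsUnimodularLattice B W L) (hW : W ≠ ⊥) :
    ∃ x y : V, IsHyperbolicPair B x y ∧ x ∈ L ∧ y ∈ L := by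
  -- `L ≠ 0` since it spans `W ≠ 0`
  obtain ⟨z, hzL, hz0⟩ : ∃ z ∈ L, z ≠ 0 := by
    by_contra H
    push Not at H
    apply hW
    rw [← hL.span_eq, Submodule.span_eq_bot]
    exact H
  obtain ⟨k, hxL, hprim⟩ := exists_primitive_multiple hϖ hL.fg hzL hz0
  obtain ⟨y, hyL, hxy⟩ := exists_apply_eq_one_of_not_mem_of_isAlt hϖ hBa hL hxL hprim
  exact ⟨_, y, isHyperbolicPair_of_isAlt hBa hxy, hxL, hyL⟩

/-- **The adapted hyperbolic pair, alternating case, `M ⊄ L`.**  For unimodular `L`, `M` in the same space `W` with `M ⊄ L`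
there are `a ≥ 1` and a hyperbolic pair `x, y ∈ L` with `ϖ^{-a} x ∈ M`, `ϖ^{a} y ∈ M`: `m ∈ M` of maximal level `a`,
`x = ϖ^a m ∈ L` primitive, `y ∈ L` a partner; `x`, `y` are isotropic because `B` is alternating, and `ϖ^a y ∈ M` by the
self-duality of `M` (`B(M, ϖ^a y) = B(ϖ^a M, y) ⊆ B(L, y) ⊆ 𝒪`).  No condition on the residue characteristic and no involution.
[cite: Jacobowitz1962, §§4–5; Omeara1963, §82F] -/
theorem exists_adapted_hyperbolicPair_of_isAlt_of_not_le {W : Submodule K V} {L M : Submodule 𝒪[K] V}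
    (hϖ : Valued.v ϖ = WithZero.exp (-1 : ℤ)) (hBa : B.IsAlt)
    (hL : IsUnimodularLattice B W L) (hM : IsUnimodularLattice B W M) (h : ¬ M ≤ L) :
    ∃ (a : ℕ) (x y : V), 1 ≤ a ∧ IsHyperbolicPair B x y ∧ x ∈ L ∧ y ∈ L ∧
      (ϖ ^ a)⁻¹ • x ∈ M ∧ (ϖ ^ a) • y ∈ M := by
  obtain ⟨a, ha1, haM, m, hm, hprim⟩ := hL.exists_primitive_of_not_le' hϖ hM h
  have hϖ0 : ϖ ≠ 0 := fun h0 => by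
    rw [h0, map_zero] at hϖ
    exact WithZero.coe_ne_zero hϖ.symm
  have hP0 : ϖ ^ a ≠ 0 := pow_ne_zero _ hϖ0
  have hx : (ϖ ^ a) • m ∈ L := haM m hm
  obtain ⟨y, hy, hxy⟩ := exists_apply_eq_one_of_not_mem_of_isAlt hϖ hBa hL hx hprim
  refine ⟨a, (ϖ ^ a) • m, y, ha1, isHyperbolicPair_of_isAlt hBa hxy, hx, hy, ?_, ?_⟩
  · rw [smul_smul, inv_mul_cancel₀ hP0, one_smul]; exact hm
  · refine hM.dual _ (W.smul_mem _ (hL.le_span hy)) fun m' hm' => ?_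
    rw [LinearMap.BilinForm.smul_right, ← LinearMap.BilinForm.smul_left]
    exact hL.integral _ (haM m' hm') _ hy

/-- **The adapted hyperbolic pair, alternating case** — both cases together: for unimodular `L`, `M` in `W ≠ ⊥` there are
`a : ℕ` and a hyperbolic pair `x, y ∈ L` with `ϖ^{-a} x ∈ M` and `ϖ^{a} y ∈ M` (`a = 0` when `M = L`).
[cite: Jacobowitz1962, §§4–5; Omeara1963, §82F] -/
theorem exists_adapted_hyperbolicPair_of_isAlt {W : Submodule K V} {L M : Submodule 𝒪[K] V}
    (hϖ : Valued.v ϖ = WithZero.exp (-1 : ℤ)) (hBa : B.IsAlt)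
    (hL : IsUnimodularLattice B W L) (hM : IsUnimodularLattice B W M) (hW : W ≠ ⊥) :
    ∃ (a : ℕ) (x y : V), IsHyperbolicPair B x y ∧ x ∈ L ∧ y ∈ L ∧ (ϖ ^ a)⁻¹ • x ∈ M ∧ (ϖ ^ a) • y ∈ M := by
  by_cases h : M ≤ L
  · have hML : M = L := hL.eq_of_le hM h
    obtain ⟨x, y, hp, hx, hy⟩ := exists_hyperbolicPair_of_isAlt hϖ hBa hL hW
    exact ⟨0, x, y, hp, hx, hy, by rw [pow_zero, inv_one, one_smul, hML]; exact hx,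
      by rw [pow_zero, one_smul, hML]; exact hy⟩
  · obtain ⟨a, x, y, -, hp, hx, hy, hxM, hyM⟩ := exists_adapted_hyperbolicPair_of_isAlt_of_not_le hϖ hBa hL hM h
    exact ⟨a, x, y, hp, hx, hy, hxM, hyM⟩

/-! ## §4 Splitting a hyperbolic plane off a unimodular lattice (alternating form) -/

section Restrict

omit [Valued K ℤᵐ⁰]

variable (B)

/-- The projection `z ↦ z + (B y z) x - (B x z) y` onto the `B`-orthogonal of the hyperbolic plane `⟨x, y⟩` of an
ALTERNATING form (`B x y = 1`, `B y x = -1`). [cite: Omeara1963, §42D] -/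
def projAlt (x y : V) : V →ₗ[K] V := LinearMap.id + (B y).smulRight x - (B x).smulRight y

variable {B} {x y z : V}

/-- `projAlt z = z + (B y z) x - (B x z) y`. [cite: Omeara1963, §42D] -/
theorem projAlt_apply (z : V) : projAlt B x y z = z + B y z • x - B x z • y := by
  simp only [projAlt, LinearMap.sub_apply, LinearMap.add_apply, LinearMap.id_apply, LinearMap.smulRight_apply]

/-- `projAlt` lands in the orthogonal of the hyperbolic plane. [cite: Omeara1963, §42D] -/
theorem projAlt_mem_orth (hBa : B.IsAlt) (hp : IsHyperbolicPair B x y) (z : V) : projAlt B x y z ∈ orth B x y := by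
  rw [mem_orth, projAlt_apply]
  refine ⟨?_, ?_⟩
  · rw [map_sub, map_add, LinearMap.BilinForm.smul_right, LinearMap.BilinForm.smul_right, hp.left, hp.pair]; ring
  · rw [map_sub, map_add, LinearMap.BilinForm.smul_right, LinearMap.BilinForm.smul_right, hp.right, pair_neg_of_isAlt hBa hp]
    ring

/-- `projAlt` is the identity on the orthogonal. [cite: Omeara1963, §42D] -/
theorem projAlt_eq_self (hz : z ∈ orth B x y) : projAlt B x y z = z := by
  rw [projAlt_apply, (mem_orth.1 hz).1, (mem_orth.1 hz).2, zero_smul, zero_smul, add_zero, sub_zero]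

/-- `z = (-(B y z) x + (B x z) y) + projAlt z`. [cite: Omeara1963, §42D] -/
theorem eq_add_projAlt (z : V) : z = (-(B y z) • x + B x z • y) + projAlt B x y z := by
  rw [projAlt_apply, neg_smul]; abel

/-- Pairing with an orthogonal vector only sees the orthogonal component. [cite: Omeara1963, §42D] -/
theorem apply_eq_apply_projAlt (hz : z ∈ orth B x y) (w : V) : B w z = B (projAlt B x y w) z := by
  obtain ⟨hxz, hyz⟩ := mem_orth.1 hz
  rw [projAlt_apply, LinearMap.BilinForm.sub_left, LinearMap.BilinForm.add_left, LinearMap.BilinForm.smul_left,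
    LinearMap.BilinForm.smul_left, hxz, hyz, mul_zero, mul_zero, add_zero, sub_zero]

/-- Orthogonal vectors pair to zero on the other side too (alternating form). [cite: Omeara1963, §42D] -/
theorem apply_eq_zero_of_mem_orth_of_isAlt (hBa : B.IsAlt) (hz : z ∈ orth B x y) : B z x = 0 ∧ B z y = 0 := by
  obtain ⟨hxz, hyz⟩ := mem_orth.1 hz
  exact ⟨by rw [← hBa.neg_eq, hxz, neg_zero], by rw [← hBa.neg_eq, hyz, neg_zero]⟩

/-- Splitting the plane decreases the dimension (for inductions; alternating form). [cite: Omeara1963, §42D] -/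
theorem finrank_inf_orth_lt_of_isAlt {W : Submodule K V} [FiniteDimensional K W] (hBa : B.IsAlt)
    (hp : IsHyperbolicPair B x y) (hx : x ∈ W) :
    Module.finrank K ↥(W ⊓ orth B x y) < Module.finrank K W := by
  refine Submodule.finrank_lt_finrank_of_lt (lt_of_le_of_ne inf_le_left fun h => ?_)
  have : x ∈ W ⊓ orth B x y := h.symm ▸ hx
  exact apply_ne_zero_of_isAlt hBa hp (mem_orth.1 this.2).2

variable [Valued K ℤᵐ⁰]

/-- **Splitting a hyperbolic plane off a unimodular lattice (alternating form).**  If the hyperbolic pair `x, y` lies in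
the unimodular lattice `N ⊆ W`, then `N' := N ∩ ⟨x, y⟩^⊥` is a unimodular lattice in `W ∩ ⟨x, y⟩^⊥` and
`N = (𝒪x + 𝒪y) ⊔ N'`. [cite: Omeara1963, §82F (82:15)] -/
theorem IsUnimodularLattice.restrict_of_isAlt {W : Submodule K V} {N : Submodule 𝒪[K] V} (hBa : B.IsAlt)
    (hN : IsUnimodularLattice B W N) (hp : IsHyperbolicPair B x y) (hx : x ∈ N) (hy : y ∈ N) :
    IsUnimodularLattice B (W ⊓ orth B x y) (N ⊓ orthInt B x y) ∧
      N = Submodule.span 𝒪[K] {x, y} ⊔ (N ⊓ orthInt B x y) := by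
  have hprojN : ∀ z ∈ N, projAlt B x y z ∈ N := fun z hz => by
    rw [projAlt_apply]
    exact N.sub_mem (N.add_mem hz (smul_mem_of_v_le N (hN.integral y hy z hz) hx))
      (smul_mem_of_v_le N (hN.integral x hx z hz) hy)
  have hmem : ∀ z ∈ N, projAlt B x y z ∈ N ⊓ orthInt B x y := fun z hz =>
    ⟨hprojN z hz, mem_orthInt.2 (mem_orth.1 (projAlt_mem_orth hBa hp z))⟩
  have heq : N ⊓ orthInt B x y = N.map ((projAlt B x y).restrictScalars 𝒪[K]) := by
    ext z
    constructor
    · rintro ⟨hzN, hzo⟩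
      exact ⟨z, hzN, projAlt_eq_self (mem_orth.2 (mem_orthInt.1 hzo))⟩
    · rintro ⟨w, hw, rfl⟩
      exact hmem w hw
  refine ⟨⟨?_, ?_, ?_, ?_⟩, ?_⟩
  · rw [heq]; exact hN.fg.map _
  · apply le_antisymm
    · rw [Submodule.span_le]
      rintro z ⟨hzN, hzo⟩
      exact ⟨hN.le_span hzN, mem_orth.2 (mem_orthInt.1 hzo)⟩
    · rintro z ⟨hzW, hzo⟩
      have hz' : z ∈ (Submodule.span K (N : Set V)).map (projAlt B x y) := by
        rw [hN.span_eq]; exact ⟨z, hzW, projAlt_eq_self hzo⟩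
      rw [Submodule.map_span] at hz'
      refine Submodule.span_mono ?_ hz'
      rintro _ ⟨w, hw, rfl⟩
      exact hmem w hw
  · intro z hz z' hz'
    exact hN.integral z hz.1 z' hz'.1
  · intro z hz h
    have hzo : z ∈ orth B x y := hz.2
    have hzN : z ∈ N := hN.dual z hz.1 fun w hw => by
      rw [apply_eq_apply_projAlt hzo w]
      exact h _ (hmem w hw)
    exact ⟨hzN, mem_orthInt.2 (mem_orth.1 hzo)⟩
  · apply le_antisymm
    · intro z hz
      rw [eq_add_projAlt (B := B) (x := x) (y := y) z]
      refine Submodule.add_mem_sup (Submodule.add_mem _ ?_ ?_) (hmem z hz)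
      · rw [neg_smul]
        exact Submodule.neg_mem _
          (smul_mem_of_v_le _ (hN.integral y hy z hz) (Submodule.subset_span (Set.mem_insert x {y})))
      · exact smul_mem_of_v_le _ (hN.integral x hx z hz)
          (Submodule.subset_span (Set.mem_insert_of_mem x (Set.mem_singleton y)))
    · refine sup_le ?_ inf_le_left
      rw [Submodule.span_le]
      rintro w (rfl | rfl)
      · exact hx
      · exact hy

end Restrict

end Literature.NumberTheory.QuadraticForms.SymplecticLatticePair

end
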